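import Summits.QuantumFields.YangMills.Theorems.FradkinShenkerFlowFiniteSusceptibilityWeakCouplingSimpleRepDetOne
import Summits.QuantumFields.YangMills.Theorems.FradkinShenkerFlowFiniteSusceptibilityWeakCouplingOddTraceActionBound
import HarnessLib

/-!
# Crux `FiniteSusceptibilityWeakCoupling` (stmt-QuantumFields-9442), line `purity-rate-split` —
# stub `stub_plaquetteCharacterOnset`: where simplicity of `G` enters the rate half

Skeleton line `purity-rate-split` of the crux
`Summit.QuantumFields.YangMills.Theses.FradkinShenkerFlow.FiniteSusceptibilityWeakCoupling` cuts the
weak-coupling finite-susceptibility input of 4-d lattice Yang–Mills for a compact simple gauge group `G` into a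
purity half (`stub_noMirrorLongRangeOrder`, group-blind) and a rate half
(`stub_decorrelationForcesSummability`), and the rate half is FALSE for `G = U(1)` in `d = 4`: the `C`-odd
plaquette observable `Im U_p = sin θ_p` is the field strength itself, it couples *linearly* to the massless
photon and its two-point function decays like `|x|⁻⁴`, which is not summable in four dimensions. So any proof
of the rate half must use the simplicity hypothesis, and this file assembles, in the ROUTE'S vocabulary
(`IsCompactSimpleLieGroup G`, `r : LatticeRep G`), the single-plaquette statement through which it enters —
the two landed helper stubs of this line composed:

* `stub_simpleRepDetOne` (landed): simple compact `G` has no non-trivial continuous character, so every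
  lattice representation lands in `SU(r.N)`: `det (r.ρ g) = 1`;
* `stub_oddTraceActionBound` (landed): on `SU(N)`, `|Im tr V| ≤ C_N · (N - Re tr V) ^ (3/2)`.

Registered stub proved here:

* `stub_plaquetteCharacterOnset` — for `G` compact simple and every `r : LatticeRep G` there is `C` with
  `|Im tr (r.ρ g)| ≤ C · (r.N - Re tr (r.ρ g)) ^ (3/2)` for all `g : G`: the `C`-odd Wilson character of a
  plaquette variable is controlled SUPER-linearly (power `3/2`) by the Wilson action density
  `r.N - Re tr (r.ρ g)`; for `U(1)` (not simple; `det = ρ` itself) the best exponent is `1/2`.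

Alongside (group-blind, no simplicity): the `C`-even part is exactly quadratic —
`PlaquetteCharacterOnset.sum_normSq_sub_one_eq`: for unitary `V`,
`∑ᵢⱼ |(V - 1)ᵢⱼ|² = 2 · (N - Re tr V)`, i.e. the Wilson action density is half the squared Frobenius distance of
the plaquette variable to the identity (`plaquette_frobenius_sq` in the route's vocabulary). Together:
"gauge invariants of a simple `G` couple to the curvature quadratically, and the odd ones only at order three"
(idea card `semisimple-quadratic-onset` of this crux, its two lemmas, now kernel-checked).

Mathlib plus the two landed stub files only; no named unproved facts are used.
-/

set_option autoImplicit false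

open Literature.MathematicalPhysics.QuantumFieldTheory

namespace Summit.QuantumFields.YangMills.Theorems.FiniteSusceptibilityWeakCoupling

namespace PlaquetteCharacterOnset

/-- The rows of a unitary matrix have unit Euclidean norm: `∑ⱼ |Vᵢⱼ|² = 1` (the diagonal of `V V* = 1`).
[folklore] -/
theorem sum_normSq_row_eq_one {N : ℕ} {V : Matrix (Fin N) (Fin N) ℂ}
    (hV : V ∈ Matrix.unitaryGroup (Fin N) ℂ) (i : Fin N) :
    ∑ j, Complex.normSq (V i j) = 1 := by
  have h : (V * star V) i i = 1 := by
    rw [Matrix.mem_unitaryGroup_iff.1 hV, Matrix.one_apply_eq]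
  rw [Matrix.mul_apply] at h
  have h' : ∑ j, ((Complex.normSq (V i j) : ℝ) : ℂ) = 1 := by
    rw [← h]
    refine Finset.sum_congr rfl fun j _ => ?_
    rw [Matrix.star_apply, Complex.star_def, Complex.mul_conj]
  exact_mod_cast h'

/-- **The `C`-even part is quadratic (group-blind).** For a unitary `V`, the squared Frobenius distance to the
identity is twice the Wilson action density: `∑ᵢⱼ |(V - 1)ᵢⱼ|² = 2 · (N - Re tr V)`
(`(V-1)*(V-1) = 2 - V - V*` and `tr V* = conj (tr V)`, done entrywise). [folklore] -/
theorem sum_normSq_sub_one_eq {N : ℕ} {V : Matrix (Fin N) (Fin N) ℂ}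
    (hV : V ∈ Matrix.unitaryGroup (Fin N) ℂ) :
    ∑ i, ∑ j, Complex.normSq ((V - 1) i j) = 2 * ((N : ℝ) - V.trace.re) := by
  have hrow := sum_normSq_row_eq_one hV
  have key : ∀ i, ∑ j, Complex.normSq ((V - 1) i j) = 2 - 2 * (V i i).re := by
    intro i
    have hterm : ∀ j, Complex.normSq ((V - 1) i j)
        = Complex.normSq (V i j) + (if i = j then 1 - 2 * (V i j).re else 0) := by
      intro j
      rw [Matrix.sub_apply, Matrix.one_apply]
      split_ifs with hij
      · rw [Complex.normSq_sub, Complex.normSq_one, map_one, mul_one]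
        ring
      · rw [sub_zero, add_zero]
    simp_rw [hterm]
    rw [Finset.sum_add_distrib, Finset.sum_ite_eq, if_pos (Finset.mem_univ i), hrow]
    ring
  simp_rw [key]
  rw [Finset.sum_sub_distrib, Finset.sum_const, Finset.card_univ, Fintype.card_fin, ← Finset.mul_sum,
    Matrix.trace, Complex.re_sum]
  simp only [Matrix.diag_apply, nsmul_eq_mul]
  ring

end PlaquetteCharacterOnset

/-- **Even part, in the route's vocabulary (group-blind).** For every lattice representation `r` of a compact
group `G` and every `g : G`, `∑ᵢⱼ |(r.ρ g - 1)ᵢⱼ|² = 2 · (r.N - Re tr (r.ρ g))`: the Wilson action density of a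
plaquette variable is half its squared Frobenius distance to the identity. [folklore] -/
theorem plaquette_frobenius_sq {G : Type} [Group G] [TopologicalSpace G] (r : LatticeRep G) (g : G) :
    ∑ i, ∑ j, Complex.normSq ((r.ρ g - 1) i j) = 2 * ((r.N : ℝ) - (r.ρ g).trace.re) :=
  PlaquetteCharacterOnset.sum_normSq_sub_one_eq (r.mem_unitary g)

/-- **Registered stub `stub_plaquetteCharacterOnset` (crux stmt-QuantumFields-9442, line `purity-rate-split`):
where simplicity enters the rate half.** For a compact simple Lie group `G` (tree sense
`IsCompactSimpleLieGroup`) and every lattice representation `r : LatticeRep G` there is a constant `C` such that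
`|Im tr (r.ρ g)| ≤ C · (r.N - Re tr (r.ρ g)) ^ (3/2)` for all `g : G` — the `C`-odd Wilson character of a
plaquette variable is bounded super-linearly by the Wilson action density. Composition of the landed stubs
`stub_simpleRepDetOne` (`det ∘ r.ρ ≡ 1`) and `stub_oddTraceActionBound` (the `SU(N)` inequality). For
`G = U(1)` the statement fails (exponent `1/2` is sharp), which is the single-plaquette shadow of the failure of
the rate half for four-dimensional compact QED. -/
theorem stub_plaquetteCharacterOnset : ∀ (G : Type) [Group G] [TopologicalSpace G] [IsTopologicalGroup G] [CompactSpace G], Literature.MathematicalPhysics.QuantumFieldTheory.IsCompactSimpleLieGroup G → ∀ (r : Literature.MathematicalPhysics.QuantumFieldTheory.LatticeRep G), ∃ C : ℝ, ∀ g : G, |(r.ρ g).trace.im| ≤ C * ((r.N : ℝ) - (r.ρ g).trace.re) ^ ((3 : ℝ) / 2) := by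
  intro G _ _ _ _ hG r
  obtain ⟨C, hC⟩ := stub_oddTraceActionBound r.N
  exact ⟨C, fun g => hC (r.ρ g) (r.mem_unitary g) (stub_simpleRepDetOne G hG r g)⟩

end Summit.QuantumFields.YangMills.Theorems.FiniteSusceptibilityWeakCoupling
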